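import Literature.NumberTheory.ModularForms.ModularCurveCharacterSheaf
import Literature.Geometry.Kaehler.RiemannSurfacePeriodMapping
import Literature.Topology.CoveringSpaces.SheafMonodromyExtension
import Literature.Topology.CoveringSpaces.UniversalCoverAssociatedCovering
import HarnessLib

/-!
# Every parabolic-null character of `Γ` is a period character of `π₁(X(Γ))`
# (Shimura §8.1–8.2: `H¹_P(Γ, ℝ) ↪ H¹(Γ∖ℍ*, ℝ)`)

Layer `Literature/NumberTheory/ModularForms`, namespace `Literature.NumberTheory.ModularForms.ModularCurve`;
sequel of `ModularCurveCharacterSheaf` (the local system `IsUPrim u` of a parabolic-null additive `u : Γ → ℝ` on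
`X(Γ) = Cpt Γ`, with unique continuation and the local extension property). G. Shimura, *Introduction to the
arithmetic theory of automorphic functions* (1971), §8.1 (8.1.1)–(8.1.4) and the beginning of §8.2 (pp. 223–233): a
parabolic cocycle of `Γ` defines a cohomology class of the compact surface `Γ∖ℍ*`, i.e. a character of its
fundamental group restricting back to `u` along `Γ → π₁`. Here this is obtained WITHOUT differential forms, by
the monodromy theorem for the sheaf of `u`-primitives on the universal cover (the tree's
`Literature.Topology.CoveringSpaces.exists_extension_of_simplyConnected`, exactly as the tree's
`MeromorphicOneForm.exists_isDevelopment` develops holomorphic differentials):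

* `IsUDev u q F` — developments of the local system along a continuous `q : A → X(Γ)`; uniqueness up to
  constants on preconnected `A` (`IsUDev.exists_eq_add_const`), stability under maps over `X(Γ)` (`.comp`), and
  ★ existence on simply connected `A` (`exists_isUDev`);
* `basePt Γ = inl(π(i))`, `loop Γ γ` (the image in `X(Γ)` of a path from `i` to `γi`), `loopClass Γ γ ∈ π₁(X(Γ), basePt)`;
* ★ `exists_character_comp_loopClass` — **for every additive parabolic-null `u : Γ → ℝ` there is an additive
  character `χ` of `π₁(X(Γ), basePt)` with `χ(loopClass γ) = u(γ)` for all `γ ∈ Γ`** (the development `H` on the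
  universal cover shifts by a constant `c(g)` under each deck transformation `g`, `c` is additive, and along the
  lift of `loop γ` the development follows `hfun u` from `i` to `γ i`, gaining `u(γ)`).

Everything is proved; definitions: `IsUDev`, `basePt`, `loopPath`, `loop`, `loopClass`.

## References

* G. Shimura, *Introduction to the arithmetic theory of automorphic functions* (1971), §8.1 (8.1.1)–(8.1.4), §8.2
  pp. 230–234. [ShimuraIATAF1971]
* S. Kobayashi, K. Nomizu, *Foundations of Differential Geometry* I (1963), Ch. VI §6, App. 7 (continuation along
  curves on a simply connected space). [KobayashiNomizu1963]
* A. Hatcher, *Algebraic Topology* (2002), §1.3 (universal cover, deck transformations). [HatcherAT2002]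
-/

noncomputable section

open scoped MatrixGroups Pointwise Topology
open Set Filter Function UpperHalfPlane
open Literature.Topology.CoveringSpaces Literature.Geometry.Kaehler

namespace Literature.NumberTheory.ModularForms

namespace ModularCurve

variable {Γ : Subgroup SL(2, ℤ)} [Γ.FiniteIndex] [IsCancelSMul (Γ : Subgroup (GL (Fin 2) ℝ)) ℍ]
variable {u : ↥(Γ : Subgroup (GL (Fin 2) ℝ)) → ℝ}

/-! ### Developments of the local system along a map -/

section Dev

variable {A : Type*} [TopologicalSpace A]

/-- **`F : A → ℝ` is a development of the local system of `u` along `q : A → X(Γ)`**: near every point, `F = G ∘ q`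
for a `u`-primitive `G` on an open neighbourhood of `q a`. [cite: ShimuraIATAF1971, §8.1 (8.1.4)] -/
def IsUDev (u : ↥(Γ : Subgroup (GL (Fin 2) ℝ)) → ℝ) (q : A → Cpt Γ) (F : A → ℝ) : Prop :=
  ∀ a : A, ∃ W : Set (Cpt Γ), IsOpen W ∧ q a ∈ W ∧ ∃ G : Cpt Γ → ℝ, IsUPrim Γ u G W ∧ F =ᶠ[𝓝 a] G ∘ q

variable {q : A → Cpt Γ} {F F' : A → ℝ}

/-- Two developments differ by a locally constant function. [cite: ShimuraIATAF1971, §8.1 (8.1.4)] -/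
theorem IsUDev.sub_eventuallyEq (hq : Continuous q) (hF : IsUDev u q F) (hF' : IsUDev u q F') (a : A) :
    ∀ᶠ b in 𝓝 a, F' b - F b = F' a - F a := by
  obtain ⟨W, hWo, haW, G, hG, hFG⟩ := hF a
  obtain ⟨W', hW'o, haW', G', hG', hFG'⟩ := hF' a
  have h := (hG.mono inter_subset_left).sub_eventuallyEq (hG'.mono inter_subset_right) (x := q a) ⟨haW, haW'⟩
  have hq' := hq.continuousAt.eventually h
  filter_upwards [hFG, hFG', hq'] with b hb hb' hbq
  rw [hb, hb', hFG.self_of_nhds, hFG'.self_of_nhds]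
  exact hbq

/-- **Uniqueness up to a constant** on a preconnected `A`. [cite: ShimuraIATAF1971, §8.1 (8.1.4)] -/
theorem IsUDev.exists_eq_add_const [PreconnectedSpace A] (hq : Continuous q) (hF : IsUDev u q F) (hF' : IsUDev u q F')
    (a₀ : A) : ∀ a, F' a = F a + (F' a₀ - F a₀) := by
  have hlc : IsLocallyConstant (fun b => F' b - F b) :=
    (IsLocallyConstant.iff_eventually_eq _).2 fun b => hF.sub_eventuallyEq hq hF' b
  intro a
  have h := hlc.apply_eq_of_preconnectedSpace a a₀
  linarith

/-- **Precomposition with a map over `X(Γ)`** (a deck transformation). [cite: HatcherAT2002, §1.3 Prop. 1.39] -/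
theorem IsUDev.comp (hF : IsUDev u q F) {τ : A → A} (hτ : Continuous τ) (hqτ : ∀ b, q (τ b) = q b) :
    IsUDev u q (F ∘ τ) := fun a => by
  obtain ⟨W, hWo, haW, G, hG, hFG⟩ := hF (τ a)
  refine ⟨W, hWo, by rw [← hqτ a]; exact haW, G, hG, ?_⟩
  have h := hτ.continuousAt.eventually hFG
  exact h.mono fun b hb => by simp only [comp_apply] at hb ⊢; rw [hb, hqτ]

/-- ★ **Existence of developments on a simply connected space** (monodromy theorem for the sheaf of local
developments, as in the tree's `MeromorphicOneForm.exists_isDevelopment`). [cite: KobayashiNomizu1963, Ch. VI §6 and App. 7] -/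
theorem exists_isUDev [SimplyConnectedSpace A] [LocallyPathConnectedSpace A] (hu : ∀ γ δ, u (γ * δ) = u γ + u δ)
    (hpar : ∀ γ : (Γ : Subgroup (GL (Fin 2) ℝ)), (γ : GL (Fin 2) ℝ).IsParabolic → u γ = 0)
    (hq : Continuous q) (a₀ : A) : ∃ F : A → ℝ, IsUDev u q F ∧ F a₀ = 0 := by
  classical
  let K : Set A → (A → ℝ) → Prop := fun U f => ∀ a ∈ U, ∃ W : Set (Cpt Γ), IsOpen W ∧ q a ∈ W ∧
    ∃ G : Cpt Γ → ℝ, IsUPrim Γ u G W ∧ f =ᶠ[𝓝 a] G ∘ q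
  have hK_mono : ∀ ⦃U U' : Set A⦄ ⦃f : A → ℝ⦄, K U f → IsOpen U' → U' ⊆ U → K U' f :=
    fun U U' f hf _ hU' a ha => hf a (hU' ha)
  have hK_sub : ∀ ⦃U : Set A⦄ ⦃f f' : A → ℝ⦄, K U f → K U f' → ∀ a ∈ U, ∀ᶠ b in 𝓝 a, f' b - f b = f' a - f a := by
    intro U f f' hf hf' a ha
    obtain ⟨W, hWo, haW, G, hG, hfG⟩ := hf a ha
    obtain ⟨W', hW'o, haW', G', hG', hfG'⟩ := hf' a ha
    have h := (hG.mono inter_subset_left).sub_eventuallyEq (hG'.mono inter_subset_right) (x := q a) ⟨haW, haW'⟩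
    have hq' := hq.continuousAt.eventually h
    filter_upwards [hfG, hfG', hq'] with b hb hb' hbq
    rw [hb, hb', hfG.self_of_nhds, hfG'.self_of_nhds]
    exact hbq
  have hK_uniq : ∀ ⦃U : Set A⦄ ⦃f f' : A → ℝ⦄, IsOpen U → IsPreconnected U → K U f → K U f' →
      ∀ ⦃x : A⦄, x ∈ U → f =ᶠ[𝓝 x] f' → EqOn f f' U := by
    intro U f f' hUo hUc hf hf' x hx hff'
    have hlc : IsLocallyConstant (fun b : U => f' b - f b) := by
      refine (IsLocallyConstant.iff_eventually_eq _).2 fun b => ?_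
      have hb := hK_sub hf hf' b b.2
      exact (continuous_subtype_val.continuousAt.eventually hb).mono fun z hz => hz
    haveI : PreconnectedSpace U := isPreconnected_iff_preconnectedSpace.1 hUc
    have h0 : f' x - f x = 0 := by rw [hff'.self_of_nhds, sub_self]
    intro y hy
    have hc : f' y - f y = f' x - f x := hlc.apply_eq_of_preconnectedSpace ⟨y, hy⟩ ⟨x, hx⟩
    rw [h0, sub_eq_zero] at hc
    exact hc.symm
  have hK_ext : ∀ x₀ : A, ∃ W : Set A, IsOpen W ∧ x₀ ∈ W ∧ IsPreconnected W ∧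
      ∀ y ∈ W, ∀ (U : Set A) (f : A → ℝ), IsOpen U → y ∈ U → K U f → ∃ f' : A → ℝ, K W f' ∧ f =ᶠ[𝓝 y] f' := by
    intro x₀
    obtain ⟨Wp, hWpo, hxWp, -, hextp⟩ := exists_isUPrim_extend hu hpar (q x₀)
    obtain ⟨-, -, -, -, Gp, hGp⟩ : ∃ W : Set (Cpt Γ), IsOpen W ∧ q x₀ ∈ W ∧ IsPreconnected W ∧ ∃ G, IsUPrim Γ u G W :=
      exists_isUPrim_nhds hu hpar (q x₀)
    set O := q ⁻¹' Wp with hO_def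
    have hOo : IsOpen O := hWpo.preimage hq
    have hxO : x₀ ∈ O := hxWp
    refine ⟨pathComponentIn O x₀, hOo.pathComponentIn x₀, mem_pathComponentIn_self hxO,
      (isPathConnected_pathComponentIn hxO).isConnected.isPreconnected, ?_⟩
    intro y hy U f hUo hyU hf
    obtain ⟨W', hW'o, hyW', G', hG', hfG'⟩ := hf y hyU
    have hyO : y ∈ O := pathComponentIn_subset hy
    -- extend the germ of `G'` at `q y` to a primitive `G''` over `Wp`
    obtain ⟨G'', hG'', hGG⟩ := hextp (q y) hyO W' G' hW'o hyW' hG'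
    refine ⟨G'' ∘ q, fun a ha => ⟨Wp, hWpo, (pathComponentIn_subset ha : a ∈ O), G'', hG'', EventuallyEq.rfl⟩, ?_⟩
    have hq' := hq.continuousAt.eventually hGG
    filter_upwards [hfG', hq'] with b hb hbq
    rw [hb, comp_apply, hbq, comp_apply]
  have hK_local : ∀ Φ : A → ℝ,
      (∀ x : A, ∃ U : Set A, IsOpen U ∧ x ∈ U ∧ ∃ f : A → ℝ, K U f ∧ EqOn Φ f U) → K univ Φ := by
    intro Φ hΦ a _
    obtain ⟨U, hUo, haU, f, hf, hΦf⟩ := hΦ a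
    obtain ⟨W, hWo, haW, G, hG, hfG⟩ := hf a haU
    refine ⟨W, hWo, haW, G, hG, ?_⟩
    exact (eventuallyEq_of_mem (hUo.mem_nhds haU) hΦf).trans hfG
  -- the initial section around `a₀`
  obtain ⟨W₀, hW₀o, haW₀, -, G₀, hG₀⟩ := exists_isUPrim_nhds hu hpar (q a₀)
  set O₀ := pathComponentIn (q ⁻¹' W₀) a₀ with hO₀
  have hO₀o : IsOpen O₀ := (hW₀o.preimage hq).pathComponentIn a₀
  have haO₀ : a₀ ∈ q ⁻¹' W₀ := haW₀
  have hO₀c : IsConnected O₀ := (isPathConnected_pathComponentIn haO₀).isConnected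
  set f₀ : A → ℝ := fun b => G₀ (q b) + (-G₀ (q a₀)) with hf₀
  have hf₀K : K O₀ f₀ := fun a ha => ⟨W₀, hW₀o, (pathComponentIn_subset ha : a ∈ q ⁻¹' W₀),
    fun z => G₀ z + (-G₀ (q a₀)), hG₀.add_const _, Eventually.of_forall fun b => rfl⟩
  obtain ⟨Φ, hΦK, hΦf₀⟩ := Literature.Topology.CoveringSpaces.exists_extension_of_simplyConnected K
    hK_mono hK_uniq hK_ext hK_local hO₀o hO₀c hf₀K
  refine ⟨Φ, fun a => ?_, ?_⟩
  · obtain ⟨W, hWo, haW, G, hG, hΦG⟩ := hΦK a (mem_univ a)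
    exact ⟨W, hWo, haW, G, hG, hΦG⟩
  · rw [hΦf₀ (mem_pathComponentIn_self haO₀), hf₀]
    simp

end Dev

/-! ### The base point, the loops `γ ↦ [π(i → γi)]` -/

variable (Γ)

omit [IsCancelSMul (Γ : Subgroup (GL (Fin 2) ℝ)) ℍ] in
/-- The base point `x₀ = π(i)` of `X(Γ)`. [cite: ShimuraIATAF1971, §8.1] -/
def basePt : Cpt Γ := inl Γ (proj Γ UpperHalfPlane.I)

omit [Γ.FiniteIndex] [IsCancelSMul (Γ : Subgroup (GL (Fin 2) ℝ)) ℍ] in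
/-- A path in `ℍ` from `i` to `γ i` (any: `ℍ` is path connected). [cite: ShimuraIATAF1971, §8.1 (8.1.2)] -/
def loopPath (γ : (Γ : Subgroup (GL (Fin 2) ℝ))) : Path UpperHalfPlane.I (γ • UpperHalfPlane.I) :=
  (PathConnectedSpace.joined _ _).somePath

omit [IsCancelSMul (Γ : Subgroup (GL (Fin 2) ℝ)) ℍ] in
/-- **The loop of `γ`**: the image in `X(Γ)` of a path from `i` to `γ i`. [cite: ShimuraIATAF1971, §8.1 (8.1.2)] -/
def loop (γ : (Γ : Subgroup (GL (Fin 2) ℝ))) : Path (basePt Γ) (basePt Γ) where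
  toFun t := inl Γ (proj Γ (loopPath Γ γ t))
  continuous_toFun := (continuous_inl Γ).comp ((continuous_proj Γ).comp (loopPath Γ γ).continuous)
  source' := by simp [basePt]
  target' := by
    simp only [Path.target, basePt]
    exact congrArg _ (proj_smul Γ γ.2 _)

omit [IsCancelSMul (Γ : Subgroup (GL (Fin 2) ℝ)) ℍ] in
/-- Values of the loop. [cite: ShimuraIATAF1971, §8.1] -/
theorem loop_apply (γ : (Γ : Subgroup (GL (Fin 2) ℝ))) (t : unitInterval) : loop Γ γ t = inl Γ (proj Γ (loopPath Γ γ t)) := rfl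

omit [IsCancelSMul (Γ : Subgroup (GL (Fin 2) ℝ)) ℍ] in
/-- **The class of `γ` in `π₁(X(Γ), x₀)`.** [cite: ShimuraIATAF1971, §8.1 (8.1.2)] -/
def loopClass (γ : (Γ : Subgroup (GL (Fin 2) ℝ))) : FundamentalGroup (Cpt Γ) (basePt Γ) :=
  FundamentalGroup.fromPath (Path.Homotopic.Quotient.mk (loop Γ γ))

variable {Γ}

/-! ### The period character -/

/-- **A development on the universal cover shifts by a constant under each deck transformation**, and the shifts
are additive. [cite: HatcherAT2002, §1.3 Prop. 1.39] [cite: ShimuraIATAF1971, §8.1 (8.1.4)] -/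
theorem exists_addHom_of_isUDev {x₀ : Cpt Γ} {H : UniversalCover (Cpt Γ) x₀ → ℝ} (hH : IsUDev u UniversalCover.proj H) :
    ∃ c : Additive (FundamentalGroup (Cpt Γ) x₀) →+ ℝ,
      ∀ (g : FundamentalGroup (Cpt Γ) x₀) (a : UniversalCover (Cpt Γ) x₀), H (g • a) = H a + c (Additive.ofMul g) := by
  haveI := pathConnectedSpace_of_connectedSpace (Cpt Γ)
  haveI := stronglyLocallyContractibleSpace_of_riemannSurface (Cpt Γ)
  -- the shift of `g`
  have hshift : ∀ g : FundamentalGroup (Cpt Γ) x₀, ∀ a,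
      H (g • a) = H a + (H (g • UniversalCover.base (Cpt Γ) x₀) - H (UniversalCover.base (Cpt Γ) x₀)) := by
    intro g
    have hg : IsUDev u UniversalCover.proj (H ∘ fun a => g • a) :=
      hH.comp (continuous_const_smul g) fun b => UniversalCover.proj_smul g b
    exact hH.exists_eq_add_const UniversalCover.continuous_proj hg (UniversalCover.base (Cpt Γ) x₀)
  refine ⟨{ toFun := fun g => H (Additive.toMul g • UniversalCover.base (Cpt Γ) x₀) - H (UniversalCover.base (Cpt Γ) x₀)
            map_zero' := by
              show H ((1 : FundamentalGroup (Cpt Γ) x₀) • _) - _ = 0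
              rw [one_smul, sub_self]
            map_add' := fun g h => ?_ }, fun g a => hshift g a⟩
  change H ((Additive.toMul g * Additive.toMul h) • _) - _ = (H (Additive.toMul g • _) - _) + (H (Additive.toMul h • _) - _)
  rw [mul_smul, hshift (Additive.toMul g) (Additive.toMul h • UniversalCover.base (Cpt Γ) x₀)]
  ring

/-- **Along the lift of `loop γ`, a development on the universal cover gains `u(γ)`**: the function
`t ↦ H(lift t) − hfun u (loopPath γ t)` is locally constant on `[0, 1]`. [cite: ShimuraIATAF1971, §8.1 (8.1.2)–(8.1.4)] -/
theorem apply_lift_loop_one (hu : ∀ γ δ, u (γ * δ) = u γ + u δ) {H : UniversalCover (Cpt Γ) (basePt Γ) → ℝ}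
    (hH : IsUDev u UniversalCover.proj H) (γ : (Γ : Subgroup (GL (Fin 2) ℝ))) :
    H (UniversalCover.lift (UniversalCover.base (Cpt Γ) (basePt Γ)) (loop Γ γ) 1) = H (UniversalCover.base (Cpt Γ) (basePt Γ)) + u γ := by
  set L := UniversalCover.lift (UniversalCover.base (Cpt Γ) (basePt Γ)) (loop Γ γ) with hL
  have hLc : Continuous L := UniversalCover.continuous_lift _ _
  -- `t ↦ H (L t) − hfun u (loopPath t)` is locally constant
  have hlc : IsLocallyConstant (fun t : unitInterval => H (L t) - hfun u (loopPath Γ γ t)) := by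
    refine (IsLocallyConstant.iff_eventually_eq _).2 fun t₀ => ?_
    obtain ⟨W, hWo, hW, G, hG, hHG⟩ := hH (L t₀)
    have hproj : ∀ t, UniversalCover.proj (L t) = inl Γ (proj Γ (loopPath Γ γ t)) := fun t => UniversalCover.proj_lift _ _ t
    have h1 : ∀ᶠ t in 𝓝 t₀, H (L t) = G (inl Γ (proj Γ (loopPath Γ γ t))) := by
      have := hLc.continuousAt.eventually hHG
      exact this.mono fun t ht => by rw [comp_apply] at ht; rw [ht, hproj]
    have hz : inl Γ (proj Γ (loopPath Γ γ t₀)) ∈ W := by rw [← hproj]; exact hW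
    have h2 : ∀ᶠ t in 𝓝 t₀, G (inl Γ (proj Γ (loopPath Γ γ t))) - hfun u (loopPath Γ γ t) =
        G (inl Γ (proj Γ (loopPath Γ γ t₀))) - hfun u (loopPath Γ γ t₀) :=
      (loopPath Γ γ).continuous.continuousAt.eventually (hG.1 _ hz)
    filter_upwards [h1, h2] with t ht ht2
    rw [ht, ht2, h1.self_of_nhds]
  have hconst := hlc.apply_eq_of_preconnectedSpace 1 0
  simp only [hL, UniversalCover.lift_zero, Path.source, Path.target] at hconst ⊢
  rw [hfun_smul hu] at hconst
  linarith

/-- ★ **Every additive parabolic-null `u : Γ → ℝ` is the restriction of a character of `π₁(X(Γ), x₀)` along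
`γ ↦ loopClass γ`.** [cite: ShimuraIATAF1971, §8.1 (8.1.1)–(8.1.4) and §8.2 p. 233] -/
theorem exists_character_comp_loopClass (hu : ∀ γ δ, u (γ * δ) = u γ + u δ)
    (hpar : ∀ γ : (Γ : Subgroup (GL (Fin 2) ℝ)), (γ : GL (Fin 2) ℝ).IsParabolic → u γ = 0) :
    ∃ χ : Additive (FundamentalGroup (Cpt Γ) (basePt Γ)) →+ ℝ,
      ∀ γ : (Γ : Subgroup (GL (Fin 2) ℝ)), χ (Additive.ofMul (loopClass Γ γ)) = u γ := by
  haveI := pathConnectedSpace_of_connectedSpace (Cpt Γ)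
  haveI := stronglyLocallyContractibleSpace_of_riemannSurface (Cpt Γ)
  haveI := Literature.Geometry.Kaehler.UniversalCover.simplyConnectedSpace_riemannSurface (basePt Γ)
  haveI := UniversalCover.locallyPathConnectedSpace (X := Cpt Γ) (x₀ := basePt Γ)
  obtain ⟨H, hH, -⟩ := exists_isUDev (A := UniversalCover (Cpt Γ) (basePt Γ)) hu hpar UniversalCover.continuous_proj
    (UniversalCover.base (Cpt Γ) (basePt Γ))
  obtain ⟨c, hc⟩ := exists_addHom_of_isUDev hH
  refine ⟨-c, fun γ => ?_⟩
  -- the lift of `loop γ` ends at `(loopClass γ)⁻¹ • base`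
  have hend := RiemannSurface.lift_base_one_eq_inv_smul (M := Cpt Γ) (x₀ := basePt Γ) (loop Γ γ)
  have h1 := apply_lift_loop_one hu hH γ
  rw [hend, hc] at h1
  change H _ + c (Additive.ofMul (loopClass Γ γ)⁻¹) = _ at h1
  rw [ofMul_inv, map_neg] at h1
  rw [AddMonoidHom.neg_apply]
  linarith

end ModularCurve

end Literature.NumberTheory.ModularForms

end
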